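import Summits.QuantumFields.BalabanUV.Beta.FP.DecimationCells
import Literature.MathematicalPhysics.QuantumFieldTheory.Balaban1983to89.Beta.TransferUV
import Summits.QuantumFields.BalabanUV.Beta.FP.LatticeTaylorPath

/-!
# `BalabanUV.Beta.FP.DecimationTail` — road «FP» for binder row D1, row N7/H3-BOOK (b3′): THE N-UNIFORM DECIMATION ∕ RIEMANN LEMMA ON THE
# SUP-NORM SHELLS OF `ℤ⁴` — cells of side `N` over the region of quartic decay are `O(1)`-accurate, uniformly in `N` and in the outer radius

HONEST DEPENDENCY (page 1, mandatory): continuum YM on T⁴ ⇐ BetaPertH ∧ nine spine estimates (0/9 proved); BetaPertH ⇐ (D1) ∧ (D4) ∧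
CAP+tail; G-an2-4 gates asym, D1 and NE2/3/4.  HONEST FRAMING (cell contract, verbatim): «discharging `BetaPertH` makes Bałaban's UV
stability UNCONDITIONAL — a real constructive-QFT result; it is NOT the continuum limit and NOT the Clay problem.»  THIS MODULE is elementary
[folklore] lattice analysis on `ℤ⁴` (finite sums only: no summability, no measure theory); it asserts nothing about Bałaban's objects, cites
nothing, mints no `Prop` fact, no `def`; 0 `sorry`.  The tiling combinatorics (`cells`, `mem_cells_iff`, `sum_blockSum_eq_sum_cells`, block geometry) is part 1 `FP/DecimationCells`.
Value = the decimation half of the TAIL COMPARISON of road FP's horizontal route (owner ruling R-FP-15, `N7-PROOF.v2.md` §3 (H3-b); `LEAVES-FP.md` row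
N7/H3-BOOK (b); FINDING F-d1leaf05g8-1: this lemma + the letter (H2-c) `hgerm` is what bounds the «second bracket» `N⁶·K(N•v) − K v` of the tail;
decay alone does not).  NOT hbook, NOT hasym, NOT D1, NOT BetaPertH, NOT continuum, NOT Clay.

ABSOLUTE RULE (cell charter, verbatim): «No internally-minted statement may enter as a cited fact. Every hypothesis is either kernel-proved in this
package or a verbatim quotation of a PUBLISHED theorem with page reference. The manuscript(s) under audit are NOT citable for their own disputed
steps — they are the thing under adjudication; programme-internal (2001/route/tribunal) claims are never citable.»

THE STATEMENT (`decimation_tail`).  For `F : ℤ⁴ → ℝ` with QUARTIC DECAY `|F z| ≤ A/(‖z‖∞+1)⁴` and QUINTIC DECAY OF THE FIRST DIFFERENCES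
`|F (z + e_i) − F z| ≤ A/(‖z‖∞+1)⁵`, for every block size `N ≥ 1` and every outer radius `R ≥ 1`:
`|N⁴ · Σ_{1 < ‖v‖∞ ≤ R} F (N•v) − Σ_{N < ‖z‖∞ ≤ N·R} F z| ≤ 22464 · A`  (and the two-radius window form `decimation_tail_window`).
(The marginal case: `Σ_{‖z‖ ≤ M} F` may grow like `log M`, yet sampling on the sub-lattice `N•ℤ⁴` with the weight `N⁴` reproduces every shell sum
`(N, N·R]` up to `O(1)`.  Used with `F z := z_μ z_ν · K a b z` for a kernel `K` with `|K| ≤ C‖z‖⁻⁶`, `|ΔK| ≤ C‖z‖⁻⁷`.)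
PROOF.  Tile `ℤ⁴` by the blocks `N•v + {0,…,N−1}⁴` (`AveragingContours.blk`∕`off`; `AffineAveraging.blockSum`): (i) the block sum over `1 < ‖v‖∞ ≤ R` is the sum of
`F` over a set squeezed between the shells `(2N−1, N·R]` and `(N, N·(R+1)−1]` (part 1 §2), so it differs from `Σ_{N<‖z‖≤NR} F` by two boundary layers of
total mass `≤ (256 + 1728)·A` (quartic decay × shell counting, §3); (ii) inside one block the first-order Taylor bound along the coordinate path
(`FP/LatticeTaylorPath.abs_taylor0D_le`) and the quintic decay of `ΔF` give `|N⁴·F(N•v) − blockSum N F v| ≤ 128·A/‖v‖∞⁵`, summable over the shells of `ℤ⁴`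
(`TransferUV.abs_sum_le_of_quintic`: `≤ 160·128·A`).
Provenance: D1 formalisation swarm, unit b2b-balaban-beta-d1-formalise-leaf-05 gen 8 (prover-b2b-balaban-beta-d1-formalise-leaf-05-g8-0), 2026-08-20.
-/


noncomputable section

namespace Summit.QuantumFields.BalabanUV.Beta.FP.DecimationTail

open Finset fwdDiff
open Literature.Probability.LatticeModels (box mem_box card_box annulus mem_annulus)
open Literature.MathematicalPhysics.QuantumFieldTheory.Balaban1983to89.Beta
open Literature.MathematicalPhysics.QuantumFieldTheory.Balaban1983to89.Beta.DyadicShell (Pt supNorm supNorm_le_iff natAbs_le_supNorm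
  exists_eq_supNorm mem_box_iff not_mem_box_iff mem_annulus_iff sum_sub_sum_eq_sdiff annulus_eq_union disjoint_annulus)
open Literature.MathematicalPhysics.QuantumFieldTheory.Balaban1983to89.Beta.TransferUV (card_annulus_succ_four_le abs_sum_le_of_quintic)
open AffineAveraging (toSite blockSum)
open AveragingContours (blk off off_mem_box blk_add_off blk_block)
open Summit.QuantumFields.BalabanUV.Beta.FP.LatticeTaylorPath (abs_taylor0D_le)
open Summit.QuantumFields.BalabanUV.Beta.FP.DecimationCells

/-! ## §3 The two boundary layers and their mass -/

variable {F : Pt → ℝ} {A : ℝ}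

/-- [folklore] The cell set of the coarse annulus `(1, R]` minus the fine annulus `(N, N·R]` lies in the OUTER layer `(N·R, N·(R+1)]`. -/
theorem cells_sdiff_subset {N : ℕ} (hN : 1 ≤ N) (R : ℕ) :
    cells N (annulus 4 1 R) \ annulus 4 N (N * R) ⊆ annulus 4 (N * R) (N * (R + 1)) := by
  intro z hz
  rw [Finset.mem_sdiff, mem_cells_iff hN, mem_annulus_iff, mem_annulus_iff] at hz
  obtain ⟨⟨h1, h2⟩, hT⟩ := hz
  rw [mem_annulus_iff]
  have hfar : N < supNorm z := lt_supNorm_of_blk hN h1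
  have hnear : supNorm z < N * (R + 1) := supNorm_lt_of_blk hN h2
  constructor
  · by_contra h
    exact hT ⟨hfar, not_lt.mp h⟩
  · exact hnear.le

/-- [folklore] The fine annulus `(N, N·R]` minus the cell set of the coarse annulus `(1, R]` lies in the INNER layer `(N, 2N]`. -/
theorem annulus_sdiff_cells_subset {N : ℕ} (hN : 1 ≤ N) (R : ℕ) :
    annulus 4 N (N * R) \ cells N (annulus 4 1 R) ⊆ annulus 4 N (2 * N) := by
  intro z hz
  rw [Finset.mem_sdiff, mem_cells_iff hN, mem_annulus_iff, mem_annulus_iff] at hz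
  obtain ⟨⟨h1, h2⟩, hS⟩ := hz
  rw [mem_annulus_iff]
  refine ⟨h1, ?_⟩
  have hR : supNorm (blk N z) ≤ R := supNorm_blk_le hN h2
  by_contra h
  have h2N : 2 * N ≤ supNorm z := by omega
  exact hS ⟨two_le_supNorm_blk hN h2N, hR⟩

/-- [folklore] Quartic decay on a finite set beyond radius `M`: `Σ_{z ∈ S} |F z| ≤ #S · A/(M+1)⁴` if every `z ∈ S` has `M < ‖z‖∞`. -/
theorem sum_abs_le_card_mul {S : Finset Pt} {M : ℕ} (hA : 0 ≤ A)
    (h0 : ∀ z : Pt, |F z| ≤ A / ((supNorm z : ℝ) + 1) ^ 4) (hS : ∀ z ∈ S, M < supNorm z) :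
    ∑ z ∈ S, |F z| ≤ (S.card : ℝ) * (A / ((M : ℝ) + 1) ^ 4) := by
  have hterm : ∀ z ∈ S, |F z| ≤ A / ((M : ℝ) + 1) ^ 4 := by
    intro z hz
    refine (h0 z).trans ?_
    have hM : (M : ℝ) + 1 ≤ (supNorm z : ℝ) + 1 := by
      have := hS z hz
      have : (M : ℝ) < (supNorm z : ℝ) := by exact_mod_cast this
      linarith
    exact div_le_div_of_nonneg_left hA (by positivity) (pow_le_pow_left₀ (by positivity) hM 4)
  calc ∑ z ∈ S, |F z| ≤ ∑ _z ∈ S, A / ((M : ℝ) + 1) ^ 4 := Finset.sum_le_sum hterm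
    _ = (S.card : ℝ) * (A / ((M : ℝ) + 1) ^ 4) := by rw [Finset.sum_const, nsmul_eq_mul]

/-- [folklore] THE INNER LAYER HAS MASS `≤ 256·A`: `Σ_{N < ‖z‖∞ ≤ 2N} |F| ≤ (4N+1)⁴·A/(N+1)⁴ ≤ 256·A`. -/
theorem sum_abs_inner_le {N : ℕ} (hA : 0 ≤ A) (h0 : ∀ z : Pt, |F z| ≤ A / ((supNorm z : ℝ) + 1) ^ 4)
    {S : Finset Pt} (hS : S ⊆ annulus 4 N (2 * N)) : ∑ z ∈ S, |F z| ≤ 256 * A := by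
  have hSN : ∀ z ∈ S, N < supNorm z := fun z hz => (mem_annulus_iff.mp (hS hz)).1
  refine (sum_abs_le_card_mul hA h0 hSN).trans ?_
  have hcard : (S.card : ℝ) ≤ (4 * (N : ℝ) + 1) ^ 4 := by
    have h1 : S.card ≤ (box 4 (2 * N)).card :=
      Finset.card_le_card (hS.trans (Finset.sdiff_subset))
    rw [card_box] at h1
    have : (S.card : ℝ) ≤ ((2 * (2 * N) + 1) ^ 4 : ℕ) := by exact_mod_cast h1
    refine this.trans (le_of_eq ?_)
    push_cast; ring
  have hN1 : (0 : ℝ) < (N : ℝ) + 1 := by positivity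
  calc (S.card : ℝ) * (A / ((N : ℝ) + 1) ^ 4) ≤ (4 * (N : ℝ) + 1) ^ 4 * (A / ((N : ℝ) + 1) ^ 4) :=
        mul_le_mul_of_nonneg_right hcard (by positivity)
    _ ≤ (4 * ((N : ℝ) + 1)) ^ 4 * (A / ((N : ℝ) + 1) ^ 4) := by
        gcongr; linarith
    _ = 256 * A := by field_simp; ring

/-- [folklore] Difference of fourth powers: `(a + b)⁴ − a⁴ ≤ 4·b·(a + b)³` for `0 ≤ a`, `0 ≤ b`. -/
theorem pow_four_sub_pow_four_le {a b : ℝ} (ha : 0 ≤ a) (hb : 0 ≤ b) : (a + b) ^ 4 - a ^ 4 ≤ 4 * b * (a + b) ^ 3 := by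
  nlinarith [mul_nonneg ha hb, mul_nonneg (mul_nonneg ha ha) hb, mul_nonneg (mul_nonneg ha hb) hb, mul_nonneg (mul_nonneg hb hb) hb,
    mul_nonneg (mul_nonneg (mul_nonneg ha ha) ha) hb]

/-- [folklore] THE OUTER LAYER HAS MASS `≤ 1728·A`: for `N, R ≥ 1`, `Σ_{N·R < ‖z‖∞ ≤ N·(R+1)} |F| ≤ 216N⁴(R+1)³ · 16A/(N(R+1))⁴ ≤ 1728·A`. -/
theorem sum_abs_outer_le {N R : ℕ} (hN : 1 ≤ N) (hR : 1 ≤ R) (hA : 0 ≤ A) (h0 : ∀ z : Pt, |F z| ≤ A / ((supNorm z : ℝ) + 1) ^ 4)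
    {S : Finset Pt} (hS : S ⊆ annulus 4 (N * R) (N * (R + 1))) : ∑ z ∈ S, |F z| ≤ 1728 * A := by
  have hSN : ∀ z ∈ S, N * R < supNorm z := fun z hz => (mem_annulus_iff.mp (hS hz)).1
  refine (sum_abs_le_card_mul hA h0 hSN).trans ?_
  -- the layer's cardinality
  have hNr : (1 : ℝ) ≤ (N : ℝ) := by exact_mod_cast hN
  have hRr : (1 : ℝ) ≤ (R : ℝ) := by exact_mod_cast hR
  set a : ℝ := 2 * ((N : ℝ) * R) + 1 with ha
  set b : ℝ := 2 * (N : ℝ) with hb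
  have ha0 : 0 ≤ a := by positivity
  have hb0 : 0 ≤ b := by positivity
  have hcard : (S.card : ℝ) ≤ (a + b) ^ 4 - a ^ 4 := by
    have hsub : box 4 (N * R) ⊆ box 4 (N * (R + 1)) :=
      Literature.Probability.LatticeModels.box_mono 4 (Nat.mul_le_mul_left N (Nat.le_succ R))
    have h1 : S.card ≤ (box 4 (N * (R + 1))).card - (box 4 (N * R)).card := by
      have := Finset.card_le_card hS
      rwa [annulus, Finset.card_sdiff, Finset.inter_eq_left.mpr hsub] at this
    rw [card_box, card_box] at h1
    have hle : (2 * (N * R) + 1) ^ 4 ≤ (2 * (N * (R + 1)) + 1) ^ 4 :=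
      Nat.pow_le_pow_left (by nlinarith) 4
    have h2 : (S.card : ℝ) ≤ (((2 * (N * (R + 1)) + 1) ^ 4 - (2 * (N * R) + 1) ^ 4 : ℕ) : ℝ) := by exact_mod_cast h1
    rw [Nat.cast_sub hle] at h2
    refine h2.trans (le_of_eq ?_)
    rw [ha, hb]; push_cast; ring
  have hlayer : (a + b) ^ 4 - a ^ 4 ≤ 216 * (N : ℝ) ^ 4 * ((R : ℝ) + 1) ^ 3 := by
    refine (pow_four_sub_pow_four_le ha0 hb0).trans ?_
    have hab : a + b ≤ 3 * ((N : ℝ) * ((R : ℝ) + 1)) := by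
      rw [ha, hb]; nlinarith [mul_le_mul hNr (show (1:ℝ) ≤ (R : ℝ) + 1 by linarith) zero_le_one (by positivity)]
    calc 4 * b * (a + b) ^ 3 ≤ 4 * b * (3 * ((N : ℝ) * ((R : ℝ) + 1))) ^ 3 := by gcongr
      _ = 216 * (N : ℝ) ^ 4 * ((R : ℝ) + 1) ^ 3 := by rw [hb]; ring
  -- the decay at the layer
  have hden : (N : ℝ) * ((R : ℝ) + 1) / 2 ≤ ((N * R : ℕ) : ℝ) + 1 := by
    push_cast; nlinarith
  have hpos : 0 < (N : ℝ) * ((R : ℝ) + 1) / 2 := by positivity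
  have hdec : A / (((N * R : ℕ) : ℝ) + 1) ^ 4 ≤ A / ((N : ℝ) * ((R : ℝ) + 1) / 2) ^ 4 :=
    div_le_div_of_nonneg_left hA (by positivity) (pow_le_pow_left₀ hpos.le hden 4)
  calc (S.card : ℝ) * (A / (((N * R : ℕ) : ℝ) + 1) ^ 4)
      ≤ (216 * (N : ℝ) ^ 4 * ((R : ℝ) + 1) ^ 3) * (A / ((N : ℝ) * ((R : ℝ) + 1) / 2) ^ 4) :=
        mul_le_mul (hcard.trans hlayer) hdec (by positivity) (by positivity)
    _ = 3456 * A / ((R : ℝ) + 1) := by field_simp; ring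
    _ ≤ 1728 * A := by
        rw [div_le_iff₀ (by positivity)]; nlinarith

/-! ## §4 One block: the first-order Taylor bound against the quintic decay of the differences -/

/-- [folklore] `#{0,…,N−1}⁴ = N⁴`. -/
theorem card_offsetBox (N : ℕ) : (AffineAveraging.box 4 N).card = N ^ 4 := by
  simp [AffineAveraging.box, Fintype.card_piFinset, Finset.card_range, Finset.prod_const, Finset.card_univ, Fintype.card_fin]

/-- [folklore] **THE CELL ERROR**: for `‖v‖∞ = m ≥ 2` and `N ≥ 1`, `|N⁴·F(N•v) − blockSum N F v| ≤ 128·A/m⁵` — `N⁴` points, each within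
`4N` coordinate steps of the anchor, every step costing `≤ A/(N(m−1)+1)⁵` (`FP/LatticeTaylorPath.abs_taylor0D_le`). -/
theorem abs_cell_error_le {N : ℕ} (hN : 1 ≤ N) (hA : 0 ≤ A)
    (h1 : ∀ (z : Pt) (i : Fin 4), |Δ_[(Pi.single i 1 : Pt)] F z| ≤ A / ((supNorm z : ℝ) + 1) ^ 5)
    {v : Pt} (hv : 2 ≤ supNorm v) :
    |(N : ℝ) ^ 4 * F ((N : ℤ) • v) - blockSum N F v| ≤ 128 * A / (supNorm v : ℝ) ^ 5 := by
  set m : ℕ := supNorm v with hm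
  have hNr : (1 : ℝ) ≤ (N : ℝ) := by exact_mod_cast hN
  have hmr : (2 : ℝ) ≤ (m : ℝ) := by exact_mod_cast hv
  -- the bound on the first differences over the coordinate box of radius `N` around the anchor
  set B : ℝ := A / ((N : ℝ) * ((m : ℝ) - 1) + 1) ^ 5 with hB
  have hden : 0 < (N : ℝ) * ((m : ℝ) - 1) + 1 := by nlinarith
  have hB0 : 0 ≤ B := div_nonneg hA (pow_nonneg hden.le 5)
  have hbox : ∀ x : Pt, (∀ i, |x i - ((N : ℤ) • v) i| ≤ (N : ℤ)) → ∀ i : Fin 4, |Δ_[(Pi.single i 1 : Pt)] F x| ≤ B := by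
    intro x hx i
    refine (h1 x i).trans ?_
    have hx' : ∀ i, |x i - (N : ℤ) * v i| ≤ (N : ℤ) := fun i => by simpa [Pi.smul_apply, smul_eq_mul] using hx i
    have hG := mul_supNorm_le_of_near hx'
    have hG' : (N : ℝ) * (m : ℝ) ≤ (supNorm x : ℝ) + N := by rw [hm]; exact_mod_cast hG
    have hle : (N : ℝ) * ((m : ℝ) - 1) + 1 ≤ (supNorm x : ℝ) + 1 := by linarith
    exact div_le_div_of_nonneg_left hA (pow_pos hden 5) (pow_le_pow_left₀ hden.le hle 5)
  -- each block point
  have hpt : ∀ b ∈ AffineAveraging.box 4 N, |F ((N : ℤ) • v + toSite b) - F ((N : ℤ) • v)| ≤ (4 : ℝ) * (N : ℝ) * B := by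
    intro b hb
    have hs : ∀ i, |toSite b i| ≤ (N : ℤ) := by
      intro i
      have hbi : b i < N := by
        have := Fintype.mem_piFinset.mp hb i
        simpa [Finset.mem_range] using this
      simp only [toSite]
      rw [abs_of_nonneg (by positivity)]
      exact_mod_cast hbi.le
    have h := abs_taylor0D_le F ((N : ℤ) • v) (toSite b) (R := N) hs hB0 hbox
    simpa using h
  -- sum over the block
  have hsum : |(N : ℝ) ^ 4 * F ((N : ℤ) • v) - blockSum N F v|
      = |∑ b ∈ AffineAveraging.box 4 N, (F ((N : ℤ) • v) - F ((N : ℤ) • v + toSite b))| := by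
    rw [Finset.sum_sub_distrib, Finset.sum_const, card_offsetBox, nsmul_eq_mul]
    push_cast
    rfl
  rw [hsum]
  calc |∑ b ∈ AffineAveraging.box 4 N, (F ((N : ℤ) • v) - F ((N : ℤ) • v + toSite b))|
      ≤ ∑ b ∈ AffineAveraging.box 4 N, |F ((N : ℤ) • v) - F ((N : ℤ) • v + toSite b)| := Finset.abs_sum_le_sum_abs _ _
    _ ≤ ∑ _b ∈ AffineAveraging.box 4 N, (4 : ℝ) * (N : ℝ) * B :=
        Finset.sum_le_sum fun b hb => by rw [abs_sub_comm]; exact hpt b hb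
    _ = (N : ℝ) ^ 4 * ((4 : ℝ) * (N : ℝ) * B) := by rw [Finset.sum_const, card_offsetBox, nsmul_eq_mul]; push_cast; ring
    _ ≤ 128 * A / (m : ℝ) ^ 5 := by
        -- `4 N⁵ A/(N(m−1)+1)⁵ ≤ 4A/(m−1)⁵ ≤ 128 A/m⁵`
        rw [hB]
        have hm1 : 0 < (m : ℝ) - 1 := by linarith
        have hkey : ((N : ℝ) * ((m : ℝ) - 1)) ^ 5 ≤ ((N : ℝ) * ((m : ℝ) - 1) + 1) ^ 5 :=
          pow_le_pow_left₀ (by positivity) (by linarith) 5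
        have hhalf : (m : ℝ) ≤ 2 * ((m : ℝ) - 1) := by linarith
        have h5 : (m : ℝ) ^ 5 ≤ 32 * ((m : ℝ) - 1) ^ 5 := by
          have := pow_le_pow_left₀ (by positivity) hhalf 5
          nlinarith
        rw [show (N : ℝ) ^ 4 * (4 * (N : ℝ) * (A / ((N : ℝ) * ((m : ℝ) - 1) + 1) ^ 5))
            = ((N : ℝ) ^ 4 * (4 * (N : ℝ) * A)) / ((N : ℝ) * ((m : ℝ) - 1) + 1) ^ 5 by ring]
        rw [div_le_div_iff₀ (pow_pos hden 5) (by positivity)]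
        have hN5 : 0 < (N : ℝ) ^ 5 := by positivity
        have hm5 : 0 < ((m : ℝ) - 1) ^ 5 := pow_pos hm1 5
        -- `N⁴·4N·A·m⁵ ≤ 128A·(N(m−1)+1)⁵`
        calc (N : ℝ) ^ 4 * (4 * (N : ℝ) * A) * (m : ℝ) ^ 5
            ≤ (N : ℝ) ^ 4 * (4 * (N : ℝ) * A) * (32 * ((m : ℝ) - 1) ^ 5) := by gcongr
          _ = 128 * A * (((N : ℝ) * ((m : ℝ) - 1)) ^ 5) := by ring
          _ ≤ 128 * A * ((N : ℝ) * ((m : ℝ) - 1) + 1) ^ 5 := by gcongr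

/-- [folklore] **THE CELL ERRORS ARE SUMMABLE OVER THE SHELLS**: `|Σ_{1 < ‖v‖∞ ≤ R} (N⁴F(N•v) − blockSum N F v)| ≤ 160·128·A`
(`TransferUV.abs_sum_le_of_quintic` on `‖v‖⁻⁵`). -/
theorem abs_sum_cell_error_le {N : ℕ} (hN : 1 ≤ N) {R : ℕ} (hR : 1 ≤ R) (hA : 0 ≤ A)
    (h1 : ∀ (z : Pt) (i : Fin 4), |Δ_[(Pi.single i 1 : Pt)] F z| ≤ A / ((supNorm z : ℝ) + 1) ^ 5) :
    |∑ v ∈ annulus 4 1 R, ((N : ℝ) ^ 4 * F ((N : ℤ) • v) - blockSum N F v)| ≤ 20480 * A := by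
  classical
  -- extend by zero to the punctured ball `(0, R]`
  set g : Pt → ℝ := fun v => if 2 ≤ supNorm v then (N : ℝ) ^ 4 * F ((N : ℤ) • v) - blockSum N F v else 0 with hg
  have hsplit : ∑ v ∈ annulus 4 1 R, ((N : ℝ) ^ 4 * F ((N : ℤ) • v) - blockSum N F v) = ∑ v ∈ annulus 4 0 R, g v := by
    rw [annulus_eq_union (Nat.zero_le 1) hR, Finset.sum_union (disjoint_annulus 0 1 R)]
    have h0 : ∑ v ∈ annulus 4 0 1, g v = 0 := by
      refine Finset.sum_eq_zero fun v hv => ?_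
      rw [mem_annulus_iff] at hv
      simp only [hg]; rw [if_neg (by omega)]
    have h1' : ∑ v ∈ annulus 4 1 R, g v = ∑ v ∈ annulus 4 1 R, ((N : ℝ) ^ 4 * F ((N : ℤ) • v) - blockSum N F v) := by
      refine Finset.sum_congr rfl fun v hv => ?_
      rw [mem_annulus_iff] at hv
      simp only [hg]; rw [if_pos (by omega)]
    rw [h0, zero_add, h1']
  rw [hsplit]
  have hshell : ∀ r, ∀ v ∈ annulus 4 r (r + 1), |g v| ≤ 128 * A / ((r : ℝ) + 1) ^ 5 := by
    intro r v hv
    have hvr : supNorm v = r + 1 := DyadicShell.supNorm_eq_of_mem_sphere hv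
    simp only [hg]
    split_ifs with h2
    · have := abs_cell_error_le hN hA h1 h2
      rw [hvr] at this; push_cast at this; exact this
    · rw [abs_zero]; positivity
  have := abs_sum_le_of_quintic (M := R) (f := g) (A := 128 * A) (by positivity) hshell
  linarith

/-! ## §5 The decimation ∕ Riemann lemma -/

/-- [folklore] **THE N-UNIFORM DECIMATION LEMMA ON THE SHELLS OF `ℤ⁴`.**  For `F : ℤ⁴ → ℝ` with `|F z| ≤ A/(‖z‖∞+1)⁴` and
`|F(z + e_i) − F z| ≤ A/(‖z‖∞+1)⁵`, every block size `N ≥ 1` and outer radius `R ≥ 1`: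
`|N⁴ · Σ_{1 < ‖v‖∞ ≤ R} F(N•v) − Σ_{N < ‖z‖∞ ≤ N·R} F z| ≤ 22464 · A`. -/
theorem decimation_tail {F : Pt → ℝ} {A : ℝ} (hA : 0 ≤ A)
    (h0 : ∀ z : Pt, |F z| ≤ A / ((supNorm z : ℝ) + 1) ^ 4)
    (h1 : ∀ (z : Pt) (i : Fin 4), |Δ_[(Pi.single i 1 : Pt)] F z| ≤ A / ((supNorm z : ℝ) + 1) ^ 5)
    {N : ℕ} (hN : 1 ≤ N) {R : ℕ} (hR : 1 ≤ R) :
    |(N : ℝ) ^ 4 * ∑ v ∈ annulus 4 1 R, F ((N : ℤ) • v) - ∑ z ∈ annulus 4 N (N * R), F z| ≤ 22464 * A := by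
  classical
  -- regroup: `N⁴ΣF(N•v) − Σ_T F = Σ (cell errors) + (Σ_S F − Σ_T F)`
  have hreg := sum_blockSum_eq_sum_cells hN F (annulus 4 1 R)
  have hcells : ∑ v ∈ annulus 4 1 R, ((N : ℝ) ^ 4 * F ((N : ℤ) • v) - blockSum N F v)
      = (N : ℝ) ^ 4 * ∑ v ∈ annulus 4 1 R, F ((N : ℤ) • v) - ∑ z ∈ cells N (annulus 4 1 R), F z := by
    rw [Finset.sum_sub_distrib, ← Finset.mul_sum, hreg]
  have hsd := sum_sub_sum_eq_sdiff (cells N (annulus 4 1 R)) (annulus 4 N (N * R)) F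
  have e : (N : ℝ) ^ 4 * ∑ v ∈ annulus 4 1 R, F ((N : ℤ) • v) - ∑ z ∈ annulus 4 N (N * R), F z
      = ∑ v ∈ annulus 4 1 R, ((N : ℝ) ^ 4 * F ((N : ℤ) • v) - blockSum N F v)
        + (∑ z ∈ cells N (annulus 4 1 R) \ annulus 4 N (N * R), F z - ∑ z ∈ annulus 4 N (N * R) \ cells N (annulus 4 1 R), F z) := by
    rw [hcells, ← hsd]; ring
  rw [e]
  have hc := abs_sum_cell_error_le hN hR hA h1
  have hout : |∑ z ∈ cells N (annulus 4 1 R) \ annulus 4 N (N * R), F z| ≤ 1728 * A :=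
    (Finset.abs_sum_le_sum_abs _ _).trans (sum_abs_outer_le hN hR hA h0 (cells_sdiff_subset hN R))
  have hin : |∑ z ∈ annulus 4 N (N * R) \ cells N (annulus 4 1 R), F z| ≤ 256 * A :=
    (Finset.abs_sum_le_sum_abs _ _).trans (sum_abs_inner_le hA h0 (annulus_sdiff_cells_subset hN R))
  calc |∑ v ∈ annulus 4 1 R, ((N : ℝ) ^ 4 * F ((N : ℤ) • v) - blockSum N F v)
        + (∑ z ∈ cells N (annulus 4 1 R) \ annulus 4 N (N * R), F z - ∑ z ∈ annulus 4 N (N * R) \ cells N (annulus 4 1 R), F z)|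
      ≤ |∑ v ∈ annulus 4 1 R, ((N : ℝ) ^ 4 * F ((N : ℤ) • v) - blockSum N F v)|
        + |∑ z ∈ cells N (annulus 4 1 R) \ annulus 4 N (N * R), F z - ∑ z ∈ annulus 4 N (N * R) \ cells N (annulus 4 1 R), F z| :=
        abs_add_le _ _
    _ ≤ 20480 * A + (1728 * A + 256 * A) := by
        gcongr
        exact (abs_sub _ _).trans (add_le_add hout hin)
    _ = 22464 * A := by ring

/-- [folklore] THE TWO-RADIUS READING used by the tail comparison (FINDING F-d1leaf05g8-1): with `g M := Σ_{0 < ‖z‖∞ ≤ M} F z`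
(the windowed sum, `annulus 4 0 M`), `|N⁴ · Σ_{1 < ‖v‖∞ ≤ R} F(N•v) − (g (N·R) − g N)| ≤ 22464 · A` for all `N, R ≥ 1`. -/
theorem decimation_tail_window {F : Pt → ℝ} {A : ℝ} (hA : 0 ≤ A)
    (h0 : ∀ z : Pt, |F z| ≤ A / ((supNorm z : ℝ) + 1) ^ 4)
    (h1 : ∀ (z : Pt) (i : Fin 4), |Δ_[(Pi.single i 1 : Pt)] F z| ≤ A / ((supNorm z : ℝ) + 1) ^ 5)
    {N : ℕ} (hN : 1 ≤ N) {R : ℕ} (hR : 1 ≤ R) :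
    |(N : ℝ) ^ 4 * ∑ v ∈ annulus 4 1 R, F ((N : ℤ) • v)
        - (∑ z ∈ annulus 4 0 (N * R), F z - ∑ z ∈ annulus 4 0 N, F z)| ≤ 22464 * A := by
  have hNR : N ≤ N * R := Nat.le_mul_of_pos_right N hR
  have hsplit : ∑ z ∈ annulus 4 0 (N * R), F z - ∑ z ∈ annulus 4 0 N, F z = ∑ z ∈ annulus 4 N (N * R), F z := by
    rw [annulus_eq_union (Nat.zero_le N) hNR, Finset.sum_union (disjoint_annulus 0 N (N * R))]; ring
  rw [hsplit]
  exact decimation_tail hA h0 h1 hN hR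

end Summit.QuantumFields.BalabanUV.Beta.FP.DecimationTail

end
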